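import Literature.MathematicalPhysics.KineticTheory.PureQuarticKernel
import Literature.MathematicalPhysics.KineticTheory.LangevinChainEnergyScale
import Literature.MathematicalPhysics.KineticTheory.LangevinChainScaleCloseness
import HarnessLib

/-!
# The driven purely quartic chain at energy scale `K⁴`: force bounds, Grönwall, dissipation identity, and closeness to the limit flow (CEHR §5, Lemma 5.10, Prop. 5.3)

Topic `Literature/MathematicalPhysics/KineticTheory`. The DETERMINISTIC (pathwise) layer of the
proof of the Lyapunov condition H2 (CEHR Theorem 5.1 / Remark 5.2) for the purely quartic chain
`pureQuarticChain μ γ = ⟨μq⁴/4, r⁴/4, γ⟩`, towards the named fact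
`CuneoEckmannHairerReyBellet2018_thm213_pureQuartic` (`PureQuarticChainNESS.lean`), in two parts
(the files `LangevinChainEnergyScale.lean` and `LangevinChainScaleCloseness.lean`, written for
`pinnedChain ω₂ lam β γ`, RE-INSTANTIATED for the purely quartic chain on the chain pipeline
`OscillatorChain.chainFlow` of `PureQuarticSDE.lean` / `PureQuarticKernel.lean`).

## Part 1 — energy at scale `K⁴` (CEHR Lemma 5.10; `μ > 0`, `γ ≥ 0`)

Cuneo–Eckmann–Hairer–Rey-Bellet, EJP 23 (2018) no. 55, §5, Lemma 5.10: at energy `H ≍ K⁴` one has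
`p ~ K²`, `q, δq ~ K` (here `ℓ_p = ℓ_i = 4`), so the forces are `O(K³)`.

* `pureQuarticChain_abs_deriv_U_le_scale`, `pureQuartic_abs_deriv_V_le_scale`,
  `pureQuarticChain_abs_momentum_le_scale`, `pureQuarticChain_sum_abs_partialQ_le_scale`,
  `pureQuarticChain_linearEnergyBound_scaleAB` — **Lemma 5.10 in linear form**:
  `|U'(q_i)| = μ|q_i|³ ≤ 4H/K + μK³`, `|V'(δq)| = |δq|³ ≤ 4H/K + K³`, `|p_i| ≤ H/K² + K²/2`, hence
  `∑_i|∂_{q_i}H| + 2γ∑_i|p_i| ≤ (A/K) H + B K³` with THE SAME constants as the pinned file,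
  `A = pinnedChainScaleA γ N` and `B = pinnedChainScaleB 0 μ 0 γ N = N(μ + N²) + γN` (the pinned
  constant at `ω₂ = 0`, `lam = μ`, `β = 0`; likewise `c₁ = pinnedChainScaleC 0 μ 0 γ N`), so that
  the downstream files port verbatim;
* `pureQuarticChain_hamiltonian_chainFlow_le_scale`, `…_le_ceiling` — Grönwall at scale `K`;
* `pureQuarticChain_hamiltonian_chainFlow_eq_smoothPart` — the energy identity with the
  dissipation (pathwise form of CEHR (3.3));
* `pureQuarticChain_hamiltonian_chainFlow_le_sub_dissipation` — the pathwise energy inequality.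

## Part 2 — the rescaled chain stays close to the limit flow: the high-energy dissipation bound (CEHR Prop. 5.3 / §5.1; `μ, γ > 0`)

The Hamiltonian of the purely quartic chain is EXACTLY homogeneous — `H = K⁴ Ĥ ∘ rescale K` with `Ĥ`
the Hamiltonian of the limiting chain `limitChain μ 1` (`Ĥ = ∑ p²/2 + μq⁴/4 + (δq)⁴/4`, CEHR
(5.22)) — so that the rescaled drift differs from the limit drift ONLY by the friction `γ/K`
(no harmonic remainder `R̃_v`, no translation gauge: `μ > 0`). The generic objects (`rescaleL`,
`scalePath`, `scaleRegion`, the Lipschitz constant of the limit drift, `shiftVec`, the bounds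
along the limit flow, `limitChainFlow`, `limitDissipation` and Prop. 5.14
`exists_le_limitDissipation`) are imported from `LangevinChainScaleCloseness.lean` /
`LangevinChainLimitFlow.lean` with `lam = μ`, `β = 1`.

* `pureQuarticChain_hamiltonian_eq_scaled`, `pureQuarticChain_dPotential_eq_scaled`,
  `pureQuartic_limitChain_hamiltonian_ge_half` — the exact scaling identities; every point with
  `H(x) ≥ K⁴` has `Ĥ(rescale K x) ≥ 1/2` (interaction regime automatic);
* `pureQuarticScaledDrift`, `pureQuartic_inv_smul_rescale_drift`, `pureQuartic_scalePath_eq` — the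
  rescaled drift `Ỹ_K = (p̃, -∇Φ̂ - (γ/K)wp̃)` and the rescaled integral equation (5.8);
* `norm_pureQuarticScaledDrift_sub_drift_le` — `‖Ỹ_K - Ŷ‖ ≤ 2γCp/K`;
* `pureQuartic_scalePath_bounds` — the rescaled driven path lives in the region (energy ceiling);
* `pureQuarticChain_dissipation_ge_interaction` — **the dissipation bound**: for `Λ > 0`,
  `δ₀ ∈ (0,1]` with `Aδ₀Λ ≤ 1` there are `K₀, ε > 0` such that for `K ≥ K₀`, `H(x) ≤ 2K⁴`,
  `Ĥ(rescale K x) ≥ 1/2` and `‖η‖ ≤ δ₀K` on `[0, Λ/K]`, `γ∫₀^{Λ/K} ∑ᵢ wᵢ ȳᵢ² ds ≥ εK³`.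

## References

* N. Cuneo, J.-P. Eckmann, M. Hairer, L. Rey-Bellet, EJP 23 (2018) no. 55 (arXiv:1712.09413),
  §3 eq. (3.3), §5 p. 11, §5.1: (5.7)–(5.12), (5.20)–(5.22), Lemma 5.8, Lemma 5.10, Lemma 5.13,
  Prop. 5.14, Lemma 5.17, proof of Prop. 5.3 (p. 15).
-/

noncomputable section

namespace Literature.MathematicalPhysics.KineticTheory.HeatConduction

/-! ## Part 1: energy of the driven chain at scale `K⁴` -/

section PartEnergyScale
open MeasureTheory Filter Topology Set Metric
open scoped NNReal
open OscillatorChain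

/-! ### Scaling bounds at energy scale `K⁴` (CEHR Lemma 5.10 in integer-power form) -/

section ScaleBounds

variable {μ : ℝ}

/-- `|U'(q_i)| = μ|q_i|³ ≤ 4H/K + μ K³` for the purely quartic chain at scale `K ≥ 1` (`μ > 0`;
`μ|q|³ ≤ μ(q⁴/K + K³)` and `μq⁴ ≤ 4H`). [cite: CuneoEckmannHairerReyBellet2018, Lemma 5.10] -/
theorem pureQuarticChain_abs_deriv_U_le_scale (hμ : 0 < μ) (γ : ℝ) (N : ℕ) {K : ℝ} (hK : 1 ≤ K)
    (x : PhaseSpace N) (i : Fin N) :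
    |deriv (pureQuarticChain μ γ).U (x.1 i)| ≤
      4 * (pureQuarticChain μ γ).hamiltonian N x / K + μ * K ^ 3 := by
  set h := (pureQuarticChain μ γ).hamiltonian N x
  set q := x.1 i
  have hK0 : 0 < K := by linarith
  have hU : μ * q ^ 4 / 4 ≤ h := pureQuarticChain_U_le_hamiltonian hμ.le γ N x i
  rw [pureQuarticChain_deriv_U, abs_mul, abs_of_pos hμ, abs_pow]
  have h3 := mul_le_mul_of_nonneg_left (abs_pow_three_le_pow_four_div_add q hK0) hμ.le
  have h4 : μ * (q ^ 4 / K + K ^ 3) = (μ * q ^ 4) / K + μ * K ^ 3 := by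
    field_simp
  have h5 : (μ * q ^ 4) / K ≤ 4 * h / K := div_le_div_of_nonneg_right (by linarith) hK0.le
  linarith [h3, h4, h5]

/-- `|V'(r)| = |r|³ ≤ 4E/K + K³` whenever `r⁴/4 ≤ E`, at scale `K ≥ 1`.
[cite: CuneoEckmannHairerReyBellet2018, Lemma 5.10] -/
theorem pureQuartic_abs_deriv_V_le_scale {r E K : ℝ} (hK : 1 ≤ K) (hE : r ^ 4 / 4 ≤ E) :
    |r ^ 3| ≤ 4 * E / K + K ^ 3 := by
  have hK0 : 0 < K := by linarith
  rw [abs_pow]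
  have h3 := abs_pow_three_le_pow_four_div_add r hK0
  have h5 : r ^ 4 / K ≤ 4 * E / K := div_le_div_of_nonneg_right (by linarith) hK0.le
  linarith

/-- `|p_i| ≤ H/K² + K²/2` for the purely quartic chain (`μ ≥ 0`, `K > 0`).
[cite: CuneoEckmannHairerReyBellet2018, Lemma 5.10] -/
theorem pureQuarticChain_abs_momentum_le_scale (hμ : 0 ≤ μ) (γ : ℝ) (N : ℕ) {K : ℝ} (hK : 0 < K)
    (x : PhaseSpace N) (i : Fin N) :
    |x.2 i| ≤ (pureQuarticChain μ γ).hamiltonian N x / K ^ 2 + K ^ 2 / 2 := by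
  set h := (pureQuarticChain μ γ).hamiltonian N x
  have hp' : x.2 i ^ 2 / 2 ≤ h := pureQuarticChain_sq_le_hamiltonian hμ γ N x i
  have h1 := abs_le_sq_div_sq_add (x.2 i) hK
  have h2 : x.2 i ^ 2 / (2 * K ^ 2) ≤ h / K ^ 2 := by
    rw [div_le_div_iff₀ (by positivity) (by positivity)]
    nlinarith [sq_nonneg K]
  linarith

/-- **The force bound at scale `K ≥ 1`** for the purely quartic chain:
`∑_i |∂_{q_i}H(x)| ≤ (4N(1+N²)/K) H(x) + N(μ + N²) K³` (`μ > 0`).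
[cite: CuneoEckmannHairerReyBellet2018, Lemma 5.10] -/
theorem pureQuarticChain_sum_abs_partialQ_le_scale (hμ : 0 < μ) (γ : ℝ) (N : ℕ) {K : ℝ}
    (hK : 1 ≤ K) (x : PhaseSpace N) :
    ∑ i, |partialQ i ((pureQuarticChain μ γ).hamiltonian N) x| ≤
      4 * N * (1 + (N : ℝ) ^ 2) / K * (pureQuarticChain μ γ).hamiltonian N x +
        N * (μ + (N : ℝ) ^ 2) * K ^ 3 := by
  set P := pureQuarticChain μ γ with hP
  set H := P.hamiltonian N x
  have hK0 : 0 < K := by linarith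
  have hH0 : 0 ≤ H := pureQuarticChain_hamiltonian_nonneg hμ.le γ N x
  have hUd : Differentiable ℝ P.U :=
    (pureQuarticChain_contDiff_U μ γ (n := 1)).differentiable one_ne_zero
  have hVd : Differentiable ℝ P.V :=
    (pureQuarticChain_contDiff_V μ γ (n := 1)).differentiable one_ne_zero
  have hbond : 0 ≤ 4 * H / K + K ^ 3 := by positivity
  have hterm : ∀ i : Fin N, |partialQ i (P.hamiltonian N) x| ≤
      (4 * H / K + μ * K ^ 3) + N ^ 2 * (4 * H / K + K ^ 3) := by
    intro i
    rw [P.partialQ_hamiltonian_eq_dPotential hUd hVd, OscillatorChain.dPotential]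
    refine (abs_add_le _ _).trans (add_le_add
      (pureQuarticChain_abs_deriv_U_le_scale hμ γ N hK x i) ?_)
    refine (Finset.abs_sum_le_sum_abs _ _).trans ?_
    have hkl : ∀ k l : Fin N, |(if l.val = k.val + 1 then
        deriv P.V (x.1 l - x.1 k) * ((if l = i then 1 else 0) - (if k = i then 1 else 0)) else 0)| ≤
        4 * H / K + K ^ 3 := by
      intro k l
      have hs : |((if l = i then (1 : ℝ) else 0) - (if k = i then 1 else 0))| ≤ 1 := by
        split_ifs <;> norm_num
      by_cases hlk : l.val = k.val + 1
      · rw [if_pos hlk, abs_mul]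
        have hV' : |deriv P.V (x.1 l - x.1 k)| ≤ 4 * H / K + K ^ 3 := by
          rw [hP, pureQuarticChain_deriv_V]
          exact pureQuartic_abs_deriv_V_le_scale hK
            (pureQuarticChain_bond_le_hamiltonian hμ.le γ N x hlk)
        calc |deriv P.V (x.1 l - x.1 k)| *
              |((if l = i then (1 : ℝ) else 0) - (if k = i then 1 else 0))|
            ≤ (4 * H / K + K ^ 3) * 1 := mul_le_mul hV' hs (abs_nonneg _) hbond
          _ = _ := mul_one _
      · rw [if_neg hlk, abs_zero]
        exact hbond
    calc ∑ k : Fin N, |∑ l : Fin N, (if l.val = k.val + 1 then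
          deriv P.V (x.1 l - x.1 k) * ((if l = i then 1 else 0) - (if k = i then 1 else 0)) else 0)|
        ≤ ∑ k : Fin N, ∑ l : Fin N, (4 * H / K + K ^ 3) :=
          Finset.sum_le_sum fun k _ => (Finset.abs_sum_le_sum_abs _ _).trans
            (Finset.sum_le_sum fun l _ => hkl k l)
      _ = N ^ 2 * (4 * H / K + K ^ 3) := by simp; ring
  calc ∑ i, |partialQ i (P.hamiltonian N) x|
      ≤ ∑ _i : Fin N, ((4 * H / K + μ * K ^ 3) + N ^ 2 * (4 * H / K + K ^ 3)) :=
        Finset.sum_le_sum fun i _ => hterm i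
    _ = _ := by
        simp only [Finset.sum_const, Finset.card_univ, Fintype.card_fin, nsmul_eq_mul]
        field_simp
        ring

/-- **The linear energy bound at scale `K ≥ 1`** for the purely quartic chain:
`∑_i |∂_{q_i}H| + 2γ ∑_i |p_i| ≤ (A/K) H + B K³` with `A = pinnedChainScaleA γ N`,
`B = pinnedChainScaleB 0 μ 0 γ N = N(μ + N²) + γN` (`μ > 0`, `γ ≥ 0`).
[cite: CuneoEckmannHairerReyBellet2018, Lemma 5.10] -/
theorem pureQuarticChain_linearEnergyBound_scaleAB (hμ : 0 < μ) {γ : ℝ} (hγ : 0 ≤ γ) (N : ℕ)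
    {K : ℝ} (hK : 1 ≤ K) (x : PhaseSpace N) :
    (∑ i, |partialQ i ((pureQuarticChain μ γ).hamiltonian N) x|) + 2 * γ * ∑ i, |x.2 i| ≤
      pinnedChainScaleA γ N / K * (pureQuarticChain μ γ).hamiltonian N x +
        pinnedChainScaleB 0 μ 0 γ N * K ^ 3 := by
  set H := (pureQuarticChain μ γ).hamiltonian N x
  have hK0 : 0 < K := by linarith
  have hH0 : 0 ≤ H := pureQuarticChain_hamiltonian_nonneg hμ.le γ N x
  have h1 := pureQuarticChain_sum_abs_partialQ_le_scale hμ γ N hK x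
  have h2 : ∑ i, |x.2 i| ≤ N * (H / K ^ 2 + K ^ 2 / 2) := by
    calc ∑ i, |x.2 i| ≤ ∑ _i : Fin N, (H / K ^ 2 + K ^ 2 / 2) :=
          Finset.sum_le_sum fun i _ => pureQuarticChain_abs_momentum_le_scale hμ.le γ N hK0 x i
      _ = N * (H / K ^ 2 + K ^ 2 / 2) := by simp [mul_add]
  have h3 : H / K ^ 2 ≤ H / K := by
    rw [div_le_div_iff₀ (by positivity) hK0]
    have : K ≤ K ^ 2 := le_self_pow₀ hK (by norm_num)
    nlinarith
  have h4 : K ^ 2 / 2 ≤ K ^ 3 / 2 := by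
    have : K ^ 2 ≤ K ^ 3 := pow_le_pow_right₀ hK (by norm_num)
    linarith
  have h5 : 2 * γ * ∑ i, |x.2 i| ≤ 2 * γ * N / K * H + γ * N * K ^ 3 := by
    have := mul_le_mul_of_nonneg_left h2 (by positivity : 0 ≤ 2 * γ)
    have h6 : 2 * γ * (N * (H / K ^ 2 + K ^ 2 / 2)) ≤ 2 * γ * (N * (H / K + K ^ 3 / 2)) := by
      gcongr
    calc 2 * γ * ∑ i, |x.2 i| ≤ 2 * γ * (N * (H / K + K ^ 3 / 2)) := this.trans h6
      _ = 2 * γ * N / K * H + γ * N * K ^ 3 := by ring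
  have h7 : (0 : ℝ) ≤ 1 / K * H := by positivity
  unfold pinnedChainScaleA pinnedChainScaleB
  have e : (4 * N * (1 + (N : ℝ) ^ 2) + 2 * γ * N + 1) / K * H +
      (N * (0 + μ + (N : ℝ) ^ 2 * (1 + 0)) + γ * N) * K ^ 3 =
      (4 * N * (1 + (N : ℝ) ^ 2) / K * H + N * (μ + (N : ℝ) ^ 2) * K ^ 3) +
        (2 * γ * N / K * H + γ * N * K ^ 3) + 1 / K * H := by ring
  rw [e]
  linarith

end ScaleBounds

/-! ### Energy along the driven flow: Grönwall at scale `K`, the exact energy identity with the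
dissipation, and the pathwise energy inequality -/

section EnergyFlow

variable {μ γ : ℝ} (hμ : 0 < μ) (hγ : 0 ≤ γ) (N : ℕ)
include hμ hγ

/-- **Grönwall at scale `K ≥ 1`**: along the flow `z = chainFlow x η` of the purely quartic chain driven
by a continuous noise path with `‖η‖ ≤ M` on `[0, T]`, the energy of the smooth part
`y = z - (0, η)` obeys `H(y(t)) + (B/A)K⁴ ≤ (H(x) + (B/A)K⁴) e^{(AM/K) t}` — the derivative of
`H∘y` is `DH(y)·Y(y + (0,η)) ≤ ‖η‖(∑|∂_qH| + 2γ∑|p|) ≤ M((A/K) H∘y + BK³)`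
(`pureQuarticChain_linearEnergyBound_scaleAB`). [cite: CuneoEckmannHairerReyBellet2018, §5 eq. before (5.7)] -/
theorem pureQuarticChain_hamiltonian_chainFlow_le_scale {K : ℝ} (hK : 1 ≤ K) (x : PhaseSpace N)
    {η : ℝ → Fin N → ℝ} (hη : Continuous η) {T M : ℝ} (hM : ∀ t ∈ Icc 0 T, ‖η t‖ ≤ M) :
    ∀ t ∈ Icc 0 T,
      (pureQuarticChain μ γ).hamiltonian N
          ((pureQuarticChain μ γ).chainFlow N x η t - ((0 : Fin N → ℝ), η t)) +
        pinnedChainScaleB 0 μ 0 γ N / pinnedChainScaleA γ N * K ^ 4 ≤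
      ((pureQuarticChain μ γ).hamiltonian N x +
          pinnedChainScaleB 0 μ 0 γ N / pinnedChainScaleA γ N * K ^ 4) *
        Real.exp (pinnedChainScaleA γ N * M / K * t) := by
  intro t ht
  set P := pureQuarticChain μ γ with hP
  set H := P.hamiltonian N with hHdef
  set Y := P.drift N with hYdef
  set z := P.chainFlow N x η with hzdef
  set A := pinnedChainScaleA γ N with hA
  set B := pinnedChainScaleB 0 μ 0 γ N with hB
  set D := B / A * K ^ 4 with hD
  have hT : 0 ≤ T := ht.1.trans ht.2
  have hM0 : 0 ≤ M := (norm_nonneg _).trans (hM 0 ⟨le_rfl, hT⟩)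
  have hK0 : 0 < K := by linarith
  have hA1 : 1 ≤ A := one_le_pinnedChainScaleA hγ N
  have hA0 : 0 < A := by linarith
  have hB0 : 0 ≤ B := pinnedChainScaleB_nonneg le_rfl hμ.le le_rfl hγ N
  have hYc : Continuous Y := (pureQuarticChain_contDiff_drift μ γ N (n := 0)).continuous
  have hzc : Continuous z := pureQuarticChain_continuous_chainFlow hμ hγ N x hη
  have hz_eq : ∀ s ∈ Icc 0 T, z s = forcing x η s + ∫ r in (0 : ℝ)..s, Y (z r) :=
    pureQuarticChain_isIntegralSolutionOn_chainFlow hμ hγ N x hη T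
  have hHs : ContDiff ℝ 1 H := pureQuarticChain_contDiff_hamiltonian μ γ N
  have hHd : Differentiable ℝ H := hHs.differentiable one_ne_zero
  set y : ℝ → PhaseSpace N := fun s => x + ∫ r in (0 : ℝ)..s, Y (z r) with hydef
  have hy_deriv : ∀ s, HasDerivAt y (Y (z s)) s := fun s => by
    have h1 : HasDerivAt (fun u => ∫ r in (0 : ℝ)..u, Y (z r)) (Y (z s)) s :=
      ((hYc.comp hzc).integral_hasStrictDerivAt 0 s).hasDerivAt
    exact h1.const_add x
  have hy_eq : ∀ s ∈ Icc 0 T, y s = z s - ((0 : Fin N → ℝ), η s) := fun s hs => by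
    rw [hz_eq s hs]
    simp only [hydef, forcing]
    abel
  have hz_y : ∀ s ∈ Icc 0 T, z s = ((y s).1, (y s).2 + η s) := fun s hs => by
    rw [hy_eq s hs]; ext i <;> simp
  set f : ℝ → ℝ := fun s => H (y s) + D with hfdef
  have hf_deriv : ∀ s, HasDerivAt f (fderiv ℝ H (y s) (Y (z s))) s := fun s =>
    ((hHd (y s)).hasFDerivAt.comp_hasDerivAt s (hy_deriv s)).add_const D
  have hf_cont : Continuous f := continuous_iff_continuousAt.2 fun s => (hf_deriv s).continuousAt
  have hbound : ∀ s ∈ Ico 0 T, fderiv ℝ H (y s) (Y (z s)) ≤ (A * M / K) * f s + 0 := by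
    intro s hs
    have hs' : s ∈ Icc 0 T := ⟨hs.1, hs.2.le⟩
    rw [hz_y s hs']
    have hγ' : 0 ≤ P.γ := hγ
    have h := P.fderiv_hamiltonian_drift_le hHd hγ' (y s) (η s)
    have hsc := pureQuarticChain_linearEnergyBound_scaleAB hμ hγ N hK (y s)
    have hH0 : 0 ≤ H (y s) := pureQuarticChain_hamiltonian_nonneg hμ.le γ N (y s)
    have hηs : ‖η s‖ ≤ M := hM s hs'
    have hnn : 0 ≤ (∑ i, |partialQ i H (y s)|) + 2 * P.γ * ∑ i, |(y s).2 i| := by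
      have : 0 ≤ ∑ i, |partialQ i H (y s)| := Finset.sum_nonneg fun i _ => abs_nonneg _
      have : 0 ≤ ∑ i, |(y s).2 i| := Finset.sum_nonneg fun i _ => abs_nonneg _
      positivity
    calc fderiv ℝ H (y s) (Y ((y s).1, (y s).2 + η s))
        ≤ ‖η s‖ * ((∑ i, |partialQ i H (y s)|) + 2 * P.γ * ∑ i, |(y s).2 i|) := h
      _ ≤ M * (A / K * H (y s) + B * K ^ 3) := mul_le_mul hηs hsc hnn hM0
      _ = (A * M / K) * f s + 0 := by
          simp only [hfdef, hD]
          field_simp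
          ring
  have hf0 : f 0 ≤ H x + D := by simp [hfdef, hydef]
  have hG := le_gronwallBound_of_liminf_deriv_right_le (f := f)
    (f' := fun s => fderiv ℝ H (y s) (Y (z s))) (δ := H x + D) (K := A * M / K) (ε := 0) (a := 0)
    (b := T) hf_cont.continuousOn (fun s _ r hr => ?_) hf0 hbound t ht
  · rw [sub_zero, gronwallBound_ε0] at hG
    have hfin : f t = H (z t - ((0 : Fin N → ℝ), η t)) + D := by
      show H (y t) + D = _
      rw [hy_eq t ht]
    rw [hfin] at hG
    exact hG
  · have := ((hf_deriv s).hasDerivWithinAt (s := Ici s)).liminf_right_slope_le hr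
    refine this.mono fun w hw => ?_
    rwa [slope_def_field, div_eq_inv_mul] at hw

/-- **The energy ceiling**: if `H(x) ≤ 2K⁴`, `‖η‖ ≤ M` on `[0, T]` and `A M T ≤ K` (`K ≥ 1`),
then `H(z(t) - (0, η(t))) ≤ c₁ K⁴` on `[0, T]`, `c₁ = pinnedChainScaleC`. [folklore] -/
theorem pureQuarticChain_hamiltonian_chainFlow_le_ceiling {K : ℝ} (hK : 1 ≤ K) (x : PhaseSpace N)
    (hx : (pureQuarticChain μ γ).hamiltonian N x ≤ 2 * K ^ 4)
    {η : ℝ → Fin N → ℝ} (hη : Continuous η) {T M : ℝ} (hM : ∀ t ∈ Icc 0 T, ‖η t‖ ≤ M)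
    (hAMT : pinnedChainScaleA γ N * M * T ≤ K) :
    ∀ t ∈ Icc 0 T,
      (pureQuarticChain μ γ).hamiltonian N
          ((pureQuarticChain μ γ).chainFlow N x η t - ((0 : Fin N → ℝ), η t)) ≤
        pinnedChainScaleC 0 μ 0 γ N * K ^ 4 := by
  intro t ht
  set A := pinnedChainScaleA γ N with hA
  set B := pinnedChainScaleB 0 μ 0 γ N with hB
  have hT : 0 ≤ T := ht.1.trans ht.2
  have hM0 : 0 ≤ M := (norm_nonneg _).trans (hM 0 ⟨le_rfl, hT⟩)
  have hK0 : 0 < K := by linarith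
  have hA1 : 1 ≤ A := one_le_pinnedChainScaleA hγ N
  have hA0 : 0 < A := by linarith
  have hB0 : 0 ≤ B := pinnedChainScaleB_nonneg le_rfl hμ.le le_rfl hγ N
  have hD0 : 0 ≤ B / A * K ^ 4 := by positivity
  have h1 := pureQuarticChain_hamiltonian_chainFlow_le_scale hμ hγ N hK x hη hM t ht
  have hexp : Real.exp (A * M / K * t) ≤ 3 := by
    have h2 : A * M / K * t ≤ 1 := by
      rw [div_mul_eq_mul_div, div_le_one hK0]
      calc A * M * t ≤ A * M * T := mul_le_mul_of_nonneg_left ht.2 (by positivity)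
        _ ≤ K := hAMT
    calc Real.exp (A * M / K * t) ≤ Real.exp 1 := Real.exp_le_exp.2 h2
      _ ≤ 3 := Real.exp_one_lt_three.le
  have h3 : ((pureQuarticChain μ γ).hamiltonian N x + B / A * K ^ 4) * Real.exp (A * M / K * t) ≤
      (2 * K ^ 4 + B / A * K ^ 4) * 3 :=
    mul_le_mul (by linarith) hexp (Real.exp_pos _).le (by positivity)
  have h4 : (2 * K ^ 4 + B / A * K ^ 4) * 3 - B / A * K ^ 4 ≤ pinnedChainScaleC 0 μ 0 γ N * K ^ 4 := by
    unfold pinnedChainScaleC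
    rw [← hA, ← hB]
    nlinarith
  linarith

/-- **The energy identity along the driven flow, with the dissipation** (the pathwise form of
CEHR (3.3) `LH = ∑_b γ_b(T_b - p_b²)`, the noise momentum `η` in place of Itô's correction): for
`z = chainFlow x η`, `y = z - (0, η)` (whose derivative is the drift `Y(z)`),
`H(z(t)) = H(x) - γ∫₀ᵗ ∑_i w_i ȳ_i² + ∫₀ᵗ ∑_i (∂_{q_i}H(y) - γ w_i ȳ_i) η_i + ∑_i (ȳ_i(t)η_i(t) + η_i(t)²/2)`,
`w_i = [i=0] + [i=N-1]`, `ȳ = y.2`. [cite: CuneoEckmannHairerReyBellet2018, §3 eq. (3.3) and §5 p. 11] -/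
theorem pureQuarticChain_hamiltonian_chainFlow_eq_smoothPart (x : PhaseSpace N) {η : ℝ → Fin N → ℝ}
    (hη : Continuous η) {t : ℝ} (ht : 0 ≤ t) :
    (pureQuarticChain μ γ).hamiltonian N ((pureQuarticChain μ γ).chainFlow N x η t) =
      (pureQuarticChain μ γ).hamiltonian N x -
        γ * (∫ s in (0 : ℝ)..t, ∑ i, bathWeight N i *
          ((pureQuarticChain μ γ).chainFlow N x η s - ((0 : Fin N → ℝ), η s)).2 i ^ 2) +
        (∫ s in (0 : ℝ)..t, ∑ i,
          (partialQ i ((pureQuarticChain μ γ).hamiltonian N)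
              ((pureQuarticChain μ γ).chainFlow N x η s - ((0 : Fin N → ℝ), η s)) -
            γ * bathWeight N i *
              ((pureQuarticChain μ γ).chainFlow N x η s - ((0 : Fin N → ℝ), η s)).2 i) * η s i) +
        ∑ i, (((pureQuarticChain μ γ).chainFlow N x η t - ((0 : Fin N → ℝ), η t)).2 i * η t i +
          η t i ^ 2 / 2) := by
  set P := pureQuarticChain μ γ with hP
  set H := P.hamiltonian N with hHdef
  set Y := P.drift N with hYdef
  set z := P.chainFlow N x η with hzdef
  have hYc : Continuous Y := (pureQuarticChain_contDiff_drift μ γ N (n := 0)).continuous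
  have hzc : Continuous z := pureQuarticChain_continuous_chainFlow hμ hγ N x hη
  have hz_eq : ∀ s ∈ Icc 0 t, z s = forcing x η s + ∫ r in (0 : ℝ)..s, Y (z r) :=
    pureQuarticChain_isIntegralSolutionOn_chainFlow hμ hγ N x hη t
  have hHs : ContDiff ℝ 1 H := pureQuarticChain_contDiff_hamiltonian μ γ N
  have hHd : Differentiable ℝ H := hHs.differentiable one_ne_zero
  set y : ℝ → PhaseSpace N := fun s => x + ∫ r in (0 : ℝ)..s, Y (z r) with hydef
  have hy_deriv : ∀ s, HasDerivAt y (Y (z s)) s := fun s => by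
    have h1 : HasDerivAt (fun u => ∫ r in (0 : ℝ)..u, Y (z r)) (Y (z s)) s :=
      ((hYc.comp hzc).integral_hasStrictDerivAt 0 s).hasDerivAt
    exact h1.const_add x
  have hyc : Continuous y := continuous_iff_continuousAt.2 fun s => (hy_deriv s).continuousAt
  have hy_eq : ∀ s ∈ Icc 0 t, y s = z s - ((0 : Fin N → ℝ), η s) := fun s hs => by
    rw [hz_eq s hs]
    simp only [hydef, forcing]
    abel
  have hz_y : ∀ s ∈ Icc 0 t, z s = ((y s).1, (y s).2 + η s) := fun s hs => by
    rw [hy_eq s hs]; ext i <;> simp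
  -- the derivative of the energy of the smooth part, and its closed form
  set ψ : ℝ → ℝ := fun s => fderiv ℝ H (y s) (Y (z s)) with hψ
  have hg_deriv : ∀ s, HasDerivAt (fun s => H (y s)) (ψ s) s := fun s =>
    (hHd (y s)).hasFDerivAt.comp_hasDerivAt s (hy_deriv s)
  have hψc : Continuous ψ := ((hHs.continuous_fderiv one_ne_zero).comp hyc).clm_apply (hYc.comp hzc)
  set W : ℝ → ℝ := fun s =>
    ∑ i, (partialQ i H (y s) - γ * bathWeight N i * (y s).2 i) * η s i with hW
  set Dis : ℝ → ℝ := fun s => ∑ i, bathWeight N i * (y s).2 i ^ 2 with hDis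
  have hψ_eq : ∀ s ∈ Icc 0 t, ψ s = W s - γ * Dis s := by
    intro s hs
    simp only [hψ, hW, hDis]
    rw [hz_y s hs, P.fderiv_hamiltonian_apply hHd]
    simp only [hYdef, OscillatorChain.drift, P.partialQ_hamiltonian_fst, Pi.add_apply]
    rw [Finset.mul_sum, ← Finset.sum_sub_distrib]
    refine Finset.sum_congr rfl fun i _ => ?_
    have hPγ : P.γ = γ := rfl
    rw [hPγ]
    ring
  -- the fundamental theorem of calculus
  have hFTC : ∫ s in (0 : ℝ)..t, ψ s = H (y t) - H (y 0) :=
    intervalIntegral.integral_eq_sub_of_hasDerivAt (fun s _ => hg_deriv s) (hψc.intervalIntegrable 0 t)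
  have hy0 : y 0 = x := by simp [hydef]
  have hQc : ∀ i, Continuous fun s => partialQ i H (y s) := fun i =>
    (P.continuous_partialQ_hamiltonian hHs i).comp hyc
  have hy2c : ∀ i, Continuous fun s => (y s).2 i := fun i =>
    (continuous_apply i).comp (continuous_snd.comp hyc)
  have hηc : ∀ i, Continuous fun s => η s i := fun i => (continuous_apply i).comp hη
  have hWc : Continuous W := by
    simp only [hW]
    exact continuous_finsetSum _ fun i _ =>
      ((hQc i).sub (continuous_const.mul (hy2c i))).mul (hηc i)
  have hDisc : Continuous Dis := by
    simp only [hDis]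
    exact continuous_finsetSum _ fun i _ => continuous_const.mul ((hy2c i).pow 2)
  have hsplit : ∫ s in (0 : ℝ)..t, ψ s = (∫ s in (0 : ℝ)..t, W s) - γ * ∫ s in (0 : ℝ)..t, Dis s := by
    rw [intervalIntegral.integral_congr (fun s hs => hψ_eq s (by rwa [uIcc_of_le ht] at hs)),
      intervalIntegral.integral_sub (hWc.intervalIntegrable _ _)
        ((hDisc.const_mul γ).intervalIntegrable _ _),
      intervalIntegral.integral_const_mul]
  -- the total energy at time `t`
  have hzt : H (z t) = H (y t) + ∑ i, ((y t).2 i * η t i + η t i ^ 2 / 2) := by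
    rw [hz_y t ⟨ht, le_rfl⟩]
    exact P.hamiltonian_add_momentum N (y t) (η t)
  -- the integrands of the statement, in terms of `y`
  have hW' : ∫ s in (0 : ℝ)..t, ∑ i, (partialQ i H (z s - ((0 : Fin N → ℝ), η s)) -
        γ * bathWeight N i * (z s - ((0 : Fin N → ℝ), η s)).2 i) * η s i =
      ∫ s in (0 : ℝ)..t, W s :=
    intervalIntegral.integral_congr fun s hs => by
      have hs' : s ∈ Icc 0 t := by rwa [uIcc_of_le ht] at hs
      simp only [hW, hy_eq s hs']
  have hDis' : ∫ s in (0 : ℝ)..t, ∑ i, bathWeight N i * (z s - ((0 : Fin N → ℝ), η s)).2 i ^ 2 =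
      ∫ s in (0 : ℝ)..t, Dis s :=
    intervalIntegral.integral_congr fun s hs => by
      have hs' : s ∈ Icc 0 t := by rwa [uIcc_of_le ht] at hs
      simp only [hDis, hy_eq s hs']
  rw [hW', hDis', hzt, hy_eq t ⟨ht, le_rfl⟩]
  rw [hy_eq t ⟨ht, le_rfl⟩, hy0] at hFTC
  linarith

/-- **The pathwise energy inequality** (CEHR §5, p. 11: "the main contribution to the energy
difference `H(z_{t*}) - H(z₀)` comes from (minus) the dissipation integral"): if `H(x) ≤ 2K⁴`,
`‖η‖ ≤ M` on `[0, T]` and `A M T ≤ K` (`K ≥ 1`), then for `t ∈ [0, T]`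
`H(z(t)) ≤ H(x) - γ∫₀ᵗ ∑_i w_i ȳ_i² + t M (A c₁ + B) K³ + N M ((c₁ + 1/2) K² + M/2)`.
[cite: CuneoEckmannHairerReyBellet2018, §5 p. 11 and Lemma 5.10] -/
theorem pureQuarticChain_hamiltonian_chainFlow_le_sub_dissipation {K : ℝ} (hK : 1 ≤ K) (x : PhaseSpace N)
    (hx : (pureQuarticChain μ γ).hamiltonian N x ≤ 2 * K ^ 4)
    {η : ℝ → Fin N → ℝ} (hη : Continuous η) {T M : ℝ} (hM : ∀ t ∈ Icc 0 T, ‖η t‖ ≤ M)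
    (hAMT : pinnedChainScaleA γ N * M * T ≤ K) {t : ℝ} (ht : t ∈ Icc 0 T) :
    (pureQuarticChain μ γ).hamiltonian N ((pureQuarticChain μ γ).chainFlow N x η t) ≤
      (pureQuarticChain μ γ).hamiltonian N x -
        γ * (∫ s in (0 : ℝ)..t, ∑ i, bathWeight N i *
          ((pureQuarticChain μ γ).chainFlow N x η s - ((0 : Fin N → ℝ), η s)).2 i ^ 2) +
        t * M * ((pinnedChainScaleA γ N * pinnedChainScaleC 0 μ 0 γ N +
          pinnedChainScaleB 0 μ 0 γ N) * K ^ 3) +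
        N * M * ((pinnedChainScaleC 0 μ 0 γ N + 1 / 2) * K ^ 2 + M / 2) := by
  set P := pureQuarticChain μ γ with hP
  set H := P.hamiltonian N with hHdef
  set z := P.chainFlow N x η with hzdef
  set A := pinnedChainScaleA γ N with hA
  set B := pinnedChainScaleB 0 μ 0 γ N with hB
  set c₁ := pinnedChainScaleC 0 μ 0 γ N with hc₁
  have hT : 0 ≤ T := ht.1.trans ht.2
  have hM0 : 0 ≤ M := (norm_nonneg _).trans (hM 0 ⟨le_rfl, hT⟩)
  have hK0 : 0 < K := by linarith
  have hA1 : 1 ≤ A := one_le_pinnedChainScaleA hγ N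
  have hB0 : 0 ≤ B := pinnedChainScaleB_nonneg le_rfl hμ.le le_rfl hγ N
  have hc0 : 0 ≤ c₁ := pinnedChainScaleC_nonneg le_rfl hμ.le le_rfl hγ N
  have hHs : ContDiff ℝ 1 H := pureQuarticChain_contDiff_hamiltonian μ γ N
  -- the energy ceiling and the bounds it implies along `[0, T]`
  have hceil : ∀ s ∈ Icc 0 T, H (z s - ((0 : Fin N → ℝ), η s)) ≤ c₁ * K ^ 4 :=
    pureQuarticChain_hamiltonian_chainFlow_le_ceiling hμ hγ N hK x hx hη hM hAMT
  have hforce : ∀ s ∈ Icc 0 T,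
      (∑ i, |partialQ i H (z s - ((0 : Fin N → ℝ), η s))|) +
          2 * γ * ∑ i, |(z s - ((0 : Fin N → ℝ), η s)).2 i| ≤ (A * c₁ + B) * K ^ 3 := by
    intro s hs
    have h1 := pureQuarticChain_linearEnergyBound_scaleAB hμ hγ N hK (z s - ((0 : Fin N → ℝ), η s))
    have h2 : A / K * H (z s - ((0 : Fin N → ℝ), η s)) ≤ A / K * (c₁ * K ^ 4) :=
      mul_le_mul_of_nonneg_left (hceil s hs) (by positivity)
    have h3 : A / K * (c₁ * K ^ 4) = A * c₁ * K ^ 3 := by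
      rw [div_mul_eq_mul_div, div_eq_iff hK0.ne']
      ring
    linarith
  have hmom : ∀ s ∈ Icc 0 T, ∀ i, |(z s - ((0 : Fin N → ℝ), η s)).2 i| ≤ (c₁ + 1 / 2) * K ^ 2 := by
    intro s hs i
    have h1 := pureQuarticChain_abs_momentum_le_scale hμ.le γ N hK0 (z s - ((0 : Fin N → ℝ), η s)) i
    have h2 : H (z s - ((0 : Fin N → ℝ), η s)) / K ^ 2 ≤ c₁ * K ^ 4 / K ^ 2 :=
      div_le_div_of_nonneg_right (hceil s hs) (by positivity)
    have h3 : c₁ * K ^ 4 / K ^ 2 = c₁ * K ^ 2 := by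
      rw [div_eq_iff (pow_ne_zero 2 hK0.ne')]
      ring
    linarith
  -- the forcing work
  have hwork : ∫ s in (0 : ℝ)..t, ∑ i, (partialQ i H (z s - ((0 : Fin N → ℝ), η s)) -
        γ * bathWeight N i * (z s - ((0 : Fin N → ℝ), η s)).2 i) * η s i ≤
      t * M * ((A * c₁ + B) * K ^ 3) := by
    have hb : ∀ s ∈ uIoc (0 : ℝ) t, ‖∑ i, (partialQ i H (z s - ((0 : Fin N → ℝ), η s)) -
        γ * bathWeight N i * (z s - ((0 : Fin N → ℝ), η s)).2 i) * η s i‖ ≤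
        M * ((A * c₁ + B) * K ^ 3) := by
      intro s hs
      have hs' : s ∈ Icc 0 T := by
        rw [uIoc_of_le ht.1] at hs
        exact ⟨hs.1.le, hs.2.trans ht.2⟩
      rw [Real.norm_eq_abs]
      refine (Finset.abs_sum_le_sum_abs _ _).trans ?_
      have hηi : ∀ i, |η s i| ≤ M := fun i =>
        (show |η s i| ≤ ‖η s‖ by rw [← Real.norm_eq_abs]; exact norm_le_pi_norm (η s) i).trans
          (hM s hs')
      have hw0 : ∀ i, 0 ≤ bathWeight N i := fun i => by unfold bathWeight; split_ifs <;> norm_num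
      have hw2 : ∀ i, bathWeight N i ≤ 2 := fun i => by unfold bathWeight; split_ifs <;> norm_num
      have hterm : ∀ i, |(partialQ i H (z s - ((0 : Fin N → ℝ), η s)) -
          γ * bathWeight N i * (z s - ((0 : Fin N → ℝ), η s)).2 i) * η s i| ≤
          (|partialQ i H (z s - ((0 : Fin N → ℝ), η s))| +
            2 * γ * |(z s - ((0 : Fin N → ℝ), η s)).2 i|) * M := by
        intro i
        rw [abs_mul]
        refine mul_le_mul ?_ (hηi i) (abs_nonneg _) (by positivity)
        refine (abs_sub _ _).trans (add_le_add le_rfl ?_)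
        rw [abs_mul, abs_mul, abs_of_nonneg hγ, abs_of_nonneg (hw0 i)]
        have := hw2 i
        have : γ * bathWeight N i * |(z s - ((0 : Fin N → ℝ), η s)).2 i| ≤
            γ * 2 * |(z s - ((0 : Fin N → ℝ), η s)).2 i| := by gcongr
        linarith
      calc ∑ i, |(partialQ i H (z s - ((0 : Fin N → ℝ), η s)) -
            γ * bathWeight N i * (z s - ((0 : Fin N → ℝ), η s)).2 i) * η s i|
          ≤ ∑ i, (|partialQ i H (z s - ((0 : Fin N → ℝ), η s))| +
              2 * γ * |(z s - ((0 : Fin N → ℝ), η s)).2 i|) * M := Finset.sum_le_sum fun i _ => hterm i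
        _ = ((∑ i, |partialQ i H (z s - ((0 : Fin N → ℝ), η s))|) +
              2 * γ * ∑ i, |(z s - ((0 : Fin N → ℝ), η s)).2 i|) * M := by
            rw [← Finset.sum_mul, Finset.sum_add_distrib, Finset.mul_sum]
        _ ≤ (A * c₁ + B) * K ^ 3 * M := mul_le_mul_of_nonneg_right (hforce s hs') hM0
        _ = M * ((A * c₁ + B) * K ^ 3) := by ring
    have h := intervalIntegral.norm_integral_le_of_norm_le_const hb
    rw [Real.norm_eq_abs, sub_zero, abs_of_nonneg ht.1] at h
    have := le_abs_self (∫ s in (0 : ℝ)..t, ∑ i, (partialQ i H (z s - ((0 : Fin N → ℝ), η s)) -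
        γ * bathWeight N i * (z s - ((0 : Fin N → ℝ), η s)).2 i) * η s i)
    nlinarith
  -- the final-time correction
  have hfin : ∑ i, ((z t - ((0 : Fin N → ℝ), η t)).2 i * η t i + η t i ^ 2 / 2) ≤
      N * M * ((c₁ + 1 / 2) * K ^ 2 + M / 2) := by
    have hηi : ∀ i, |η t i| ≤ M := fun i =>
      (show |η t i| ≤ ‖η t‖ by rw [← Real.norm_eq_abs]; exact norm_le_pi_norm (η t) i).trans (hM t ht)
    have hterm : ∀ i, (z t - ((0 : Fin N → ℝ), η t)).2 i * η t i + η t i ^ 2 / 2 ≤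
        M * ((c₁ + 1 / 2) * K ^ 2 + M / 2) := by
      intro i
      have h1 : (z t - ((0 : Fin N → ℝ), η t)).2 i * η t i ≤ (c₁ + 1 / 2) * K ^ 2 * M := by
        calc (z t - ((0 : Fin N → ℝ), η t)).2 i * η t i
            ≤ |(z t - ((0 : Fin N → ℝ), η t)).2 i * η t i| := le_abs_self _
          _ = |(z t - ((0 : Fin N → ℝ), η t)).2 i| * |η t i| := abs_mul _ _
          _ ≤ (c₁ + 1 / 2) * K ^ 2 * M :=
              mul_le_mul (hmom t ht i) (hηi i) (abs_nonneg _) (by positivity)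
      have h2 : η t i ^ 2 ≤ M ^ 2 := by
        have := hηi i
        rw [← sq_abs]
        exact pow_le_pow_left₀ (abs_nonneg _) this 2
      nlinarith
    calc ∑ i, ((z t - ((0 : Fin N → ℝ), η t)).2 i * η t i + η t i ^ 2 / 2)
        ≤ ∑ _i : Fin N, M * ((c₁ + 1 / 2) * K ^ 2 + M / 2) := Finset.sum_le_sum fun i _ => hterm i
      _ = N * M * ((c₁ + 1 / 2) * K ^ 2 + M / 2) := by
          simp only [Finset.sum_const, Finset.card_univ, Fintype.card_fin, nsmul_eq_mul]
          ring
  have hid := pureQuarticChain_hamiltonian_chainFlow_eq_smoothPart hμ hγ N x hη ht.1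
  rw [← hP, ← hHdef, ← hzdef] at hid
  linarith [hid, hwork, hfin]

end EnergyFlow

end PartEnergyScale

/-! ## Part 2: closeness of the rescaled chain to the limit flow and the dissipation bound -/

section PartScaleCloseness
open MeasureTheory Filter Topology Set Metric Function
open scoped NNReal
open OscillatorChain Literature.Analysis.ODE

variable {N : ℕ}

/-! ### The exact scaling identities of the purely quartic chain -/

section Scaling

variable {N : ℕ}

/-- **The energy rescales exactly**: `H(z) = K⁴ Ĥ(rescale K z)` with `Ĥ` the Hamiltonian of
`limitChain μ 1` (the purely quartic Hamiltonian is homogeneous of degree `4` under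
`(q, p) ↦ (Kq, K²p)`; CEHR (5.20)–(5.22) with no lower-order terms).
[cite: CuneoEckmannHairerReyBellet2018, §5.1 eq. (5.20)] -/
theorem pureQuarticChain_hamiltonian_eq_scaled (μ γ : ℝ) {a : ℝ} (ha : a ≠ 0) (N : ℕ)
    (z : PhaseSpace N) :
    (pureQuarticChain μ γ).hamiltonian N z =
      a ^ 4 * (limitChain μ 1).hamiltonian N (rescale a z) := by
  unfold OscillatorChain.hamiltonian pureQuarticChain limitChain
  simp only [rescale_fst, rescale_snd]
  rw [mul_add, Finset.mul_sum, Finset.mul_sum]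
  congr 1
  · refine Finset.sum_congr rfl fun i _ => ?_
    field_simp
  · refine Finset.sum_congr rfl fun i _ => ?_
    rw [Finset.mul_sum]
    refine Finset.sum_congr rfl fun j _ => ?_
    split_ifs
    · field_simp
    · rw [mul_zero]

/-- **The force rescales exactly**: `a⁻³ ∂_iΦ(q) = ∂_iΦ̂(a⁻¹q)` (`Φ̂` the potential of
`limitChain μ 1`). [cite: CuneoEckmannHairerReyBellet2018, §5.1 eq. (5.21)] -/
theorem pureQuarticChain_dPotential_eq_scaled (μ γ : ℝ) {a : ℝ} (ha : a ≠ 0) (N : ℕ) (i : Fin N)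
    (q : Fin N → ℝ) :
    (a ^ 3)⁻¹ * (pureQuarticChain μ γ).dPotential N i q =
      (limitChain μ 1).dPotential N i (fun j => a⁻¹ * q j) := by
  rw [(pureQuarticChain μ γ).dPotential_eq_closed, limitChain_dPotential_eq]
  simp only [pureQuarticChain_deriv_U, pureQuarticChain_deriv_V]
  split_ifs <;> field_simp <;> ring

/-- **The limit energy of the rescaled point is at least `1/2`** as soon as `K⁴ ≤ H(x)`
(indeed `Ĥ(rescale K x) = K⁻⁴H(x) ≥ 1`): for the purely quartic chain every high-energy point is
in the "interaction regime" of CEHR §5.1 (`ℓ_i = ℓ_p`).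
[cite: CuneoEckmannHairerReyBellet2018, §5.1 Lemma 5.13] -/
theorem pureQuartic_limitChain_hamiltonian_ge_half (μ γ : ℝ) {K : ℝ} (hK : 0 < K) (N : ℕ)
    {x : PhaseSpace N} (hx : K ^ 4 ≤ (pureQuarticChain μ γ).hamiltonian N x) :
    1 / 2 ≤ (limitChain μ 1).hamiltonian N (rescale K x) := by
  have h := pureQuarticChain_hamiltonian_eq_scaled μ γ hK.ne' N x
  have hK4 : 0 < K ^ 4 := by positivity
  have h1 : 1 ≤ (limitChain μ 1).hamiltonian N (rescale K x) := by
    refine le_of_mul_le_mul_left ?_ hK4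
    rw [mul_one, ← h]
    exact hx
  linarith

end Scaling

/-! ### The rescaled drift and the rescaled integral equation -/

/-- The **rescaled drift** of the purely quartic chain at scale `K`: `Ỹ_K(q̃, p̃) = (p̃, -∇Φ̂(q̃) - (γ/K) w p̃)`
with `Φ̂` the potential of `limitChain μ 1` (CEHR (5.8): for the EXACTLY homogeneous purely quartic
chain the rescaled potential is the limiting potential (5.22) at every scale; only the friction
`E^{1/ℓ_i-1/2}γ = γ/K` remembers `K`).
[cite: CuneoEckmannHairerReyBellet2018, §5.1 eq. (5.8)] -/
def pureQuarticScaledDrift (μ γ : ℝ) (N : ℕ) (K : ℝ) (z : PhaseSpace N) : PhaseSpace N :=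
  (z.2, fun i => -(limitChain μ 1).dPotential N i z.1 - γ / K * bathWeight N i * z.2 i)

section RescaledEquation

variable {μ γ : ℝ}

/-- **The drift rescales to the rescaled drift**: `K⁻¹ • rescale K (Y(z)) = Ỹ_K(rescale K z)` for the
purely quartic chain (`K ≠ 0`; the force scales like `K³`, `pureQuarticChain_dPotential_eq_scaled`).
[cite: CuneoEckmannHairerReyBellet2018, §5.1 eq. (5.8)] -/
theorem pureQuartic_inv_smul_rescale_drift {K : ℝ} (hK : K ≠ 0) (z : PhaseSpace N) :
    K⁻¹ • rescale K ((pureQuarticChain μ γ).drift N z) = pureQuarticScaledDrift μ γ N K (rescale K z) := by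
  have hUd : Differentiable ℝ (pureQuarticChain μ γ).U :=
    (pureQuarticChain_contDiff_U μ γ (n := 1)).differentiable one_ne_zero
  have hVd : Differentiable ℝ (pureQuarticChain μ γ).V :=
    (pureQuarticChain_contDiff_V μ γ (n := 1)).differentiable one_ne_zero
  ext i
  · simp only [Prod.smul_fst, Pi.smul_apply, rescale_fst, OscillatorChain.drift, smul_eq_mul, pureQuarticScaledDrift,
      rescale_snd]
    rw [sq]
    ring
  · simp only [Prod.smul_snd, Pi.smul_apply, rescale_snd, OscillatorChain.drift, smul_eq_mul, pureQuarticScaledDrift,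
      (pureQuarticChain μ γ).partialQ_hamiltonian_eq_dPotential hUd hVd]
    have h := pureQuarticChain_dPotential_eq_scaled μ γ hK N i z.1
    have hγ : (pureQuarticChain μ γ).γ = γ := rfl
    have h' : (rescale K z).1 = fun j => K⁻¹ * z.1 j := rfl
    rw [hγ, h', ← h]
    field_simp

/-- **The rescaled integral equation**: if `z(s) = x + (0, η(s)) + ∫₀ˢ Y(z)` on `[0, Λ/K]` (the
driven purely quartic chain, `LangevinChainSDE.lean`), then on `[0, Λ]`
`z̃(σ) = x̃ + (0, K⁻²η(σ/K)) + ∫₀^σ Ỹ_K(z̃(σ')) dσ'` (`z̃ = scalePath K z`, `x̃ = rescale K x`).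
[cite: CuneoEckmannHairerReyBellet2018, §5.1 eq. (5.8)] -/
theorem pureQuartic_scalePath_eq {K : ℝ} (hK : 0 < K) {x : PhaseSpace N} {η : ℝ → Fin N → ℝ}
    {z : ℝ → PhaseSpace N} (hzc : Continuous z) {Λ : ℝ}
    (hz : ∀ s ∈ Icc 0 (Λ / K), z s = x + ((0 : Fin N → ℝ), η s) +
      ∫ r in (0 : ℝ)..s, (pureQuarticChain μ γ).drift N (z r))
    {σ : ℝ} (hσ : σ ∈ Icc 0 Λ) :
    scalePath K z σ = rescale K x + ((0 : Fin N → ℝ), fun i => (K ^ 2)⁻¹ * η (σ / K) i) +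
      ∫ r in (0 : ℝ)..σ, pureQuarticScaledDrift μ γ N K (scalePath K z r) := by
  set P := pureQuarticChain μ γ with hP
  have hYc : Continuous (P.drift N) := (pureQuarticChain_contDiff_drift μ γ N (n := 0)).continuous
  have hσK : σ / K ∈ Icc 0 (Λ / K) := ⟨div_nonneg hσ.1 hK.le, div_le_div_of_nonneg_right hσ.2 hK.le⟩
  unfold scalePath
  rw [hz (σ / K) hσK, rescale_add, rescale_add]
  have h1 : rescale K (((0 : Fin N → ℝ), η (σ / K)) : PhaseSpace N) =
      ((0 : Fin N → ℝ), fun i => (K ^ 2)⁻¹ * η (σ / K) i) := by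
    ext i <;> simp [rescale]
  have h2 : rescale K (∫ r in (0 : ℝ)..σ / K, P.drift N (z r)) =
      ∫ r in (0 : ℝ)..σ / K, rescale K (P.drift N (z r)) := by
    have hint : IntervalIntegrable (fun r => P.drift N (z r)) volume 0 (σ / K) :=
      (hYc.comp hzc).intervalIntegrable _ _
    rw [← rescaleL_apply, ← (rescaleL K).intervalIntegral_comp_comm hint]
    simp only [rescaleL_apply]
  have h3 : ∫ r in (0 : ℝ)..σ, pureQuarticScaledDrift μ γ N K (rescale K (z (r / K))) =
      ∫ r in (0 : ℝ)..σ / K, rescale K (P.drift N (z r)) := by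
    have h4 : ∀ r, pureQuarticScaledDrift μ γ N K (rescale K (z (r / K))) =
        K⁻¹ • rescale K (P.drift N (z (r / K))) := fun r => (pureQuartic_inv_smul_rescale_drift hK.ne' _).symm
    simp_rw [h4]
    rw [intervalIntegral.integral_smul, intervalIntegral.inv_smul_integral_comp_div
      (f := fun r => rescale K (P.drift N (z r))), zero_div]
  rw [h1, h2, h3]

end RescaledEquation
/-- The rescaled drift `Ỹ_K` is continuous. [folklore] -/
theorem continuous_pureQuarticScaledDrift (μ γ : ℝ) (N : ℕ) (K : ℝ) :
    Continuous (pureQuarticScaledDrift μ γ N K) := by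
  have hF : ∀ i, Continuous fun z : PhaseSpace N => (limitChain μ 1).dPotential N i z.1 :=
    fun i => ((limitChain μ 1).contDiff_dPotential (limitChain_contDiff_U μ 1)
      (limitChain_contDiff_V μ 1) N i).continuous.comp continuous_fst
  unfold pureQuarticScaledDrift
  refine continuous_snd.prodMk (continuous_pi fun i => ?_)
  exact (hF i).neg.sub (continuous_const.mul ((continuous_apply i).comp continuous_snd))

/-! ### The perturbation: only the friction `γ/K` -/

section Perturbation

variable {μ γ : ℝ}

/-- **The perturbation is `O(1/K)`**: for the exactly homogeneous purely quartic chain the rescaled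
drift differs from the limit drift `Ŷ` of `limitChain μ 1` ONLY by the friction `(γ/K) w p̃`, so on
data with `|p̃_i| ≤ Cp`, `‖Ỹ_K(z̃) - Ŷ(z̃)‖ ≤ 2γCp/K` (`γ ≥ 0`, `K > 0`; CEHR (5.8)/(5.12): here
`R̃_v ≡ 0`). [cite: CuneoEckmannHairerReyBellet2018, Lemma 5.13 and eq. (5.12)] -/
theorem norm_pureQuarticScaledDrift_sub_drift_le (hγ : 0 ≤ γ) {K : ℝ} (hK : 0 < K)
    {Cp : ℝ} (hCp : 0 ≤ Cp) {z : PhaseSpace N} (hp : ∀ i, |z.2 i| ≤ Cp) :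
    ‖pureQuarticScaledDrift μ γ N K z - (limitChain μ 1).drift N z‖ ≤ 2 * γ * Cp / K := by
  have hUd : Differentiable ℝ (limitChain μ 1).U :=
    (limitChain_contDiff_U μ 1 (n := 1)).differentiable one_ne_zero
  have hVd : Differentiable ℝ (limitChain μ 1).V :=
    (limitChain_contDiff_V μ 1 (n := 1)).differentiable one_ne_zero
  have hγl : (limitChain μ 1).γ = 0 := rfl
  have hw0 : ∀ i, 0 ≤ bathWeight N i := fun i => by unfold bathWeight; split_ifs <;> norm_num
  have hw2 : ∀ i, bathWeight N i ≤ 2 := fun i => by unfold bathWeight; split_ifs <;> norm_num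
  have hbound : 0 ≤ 2 * γ * Cp / K := by positivity
  rw [Prod.norm_def]
  refine max_le ?_ ?_
  · have : (pureQuarticScaledDrift μ γ N K z - (limitChain μ 1).drift N z).1 = 0 := by
      ext i; simp [pureQuarticScaledDrift, OscillatorChain.drift]
    rw [this, norm_zero]
    exact hbound
  · refine (pi_norm_le_iff_of_nonneg hbound).2 fun i => ?_
    rw [Real.norm_eq_abs]
    have hcomp : (pureQuarticScaledDrift μ γ N K z - (limitChain μ 1).drift N z).2 i =
        -(γ / K * bathWeight N i * z.2 i) := by
      simp only [Prod.snd_sub, Pi.sub_apply, pureQuarticScaledDrift, OscillatorChain.drift, hγl,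
        zero_mul, sub_zero, (limitChain μ 1).partialQ_hamiltonian_eq_dPotential hUd hVd]
      ring
    rw [hcomp, abs_neg, abs_mul, abs_mul, abs_of_nonneg (div_nonneg hγ hK.le), abs_of_nonneg (hw0 i)]
    calc γ / K * bathWeight N i * |z.2 i| ≤ γ / K * 2 * Cp := by
          refine mul_le_mul (mul_le_mul_of_nonneg_left (hw2 i) (div_nonneg hγ hK.le)) (hp i)
            (abs_nonneg _) (by positivity)
      _ = 2 * γ * Cp / K := by ring

end Perturbation

/-! ### The rescaled driven path lives in the region (energy ceiling), and so does the reference -/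

section DrivenPath

variable {μ γ : ℝ} (hμ : 0 < μ) (hγ : 0 ≤ γ) (N : ℕ)
include hμ hγ

/-- **Bounds along the rescaled driven path** `z̃(σ) = rescale K (z(σ/K))`, `σ ∈ [0, Λ]`, from the
energy ceiling `H(y) ≤ c₁K⁴` of `LangevinChainEnergyScale.lean` (`H(x) ≤ 2K⁴`, `‖η‖ ≤ δ₀K` on
`[0, Λ/K]`, `δ₀ ≤ 1`, `Aδ₀Λ ≤ 1`, `K ≥ 1`): rescaled momenta `≤ c₁ + 3/2`, bond stretches
`≤ max(1, 4c₁)`, `μ q̃² ≤ μ + 4c₁`, and the rescaled momentum differs from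
the rescaled smooth momentum `K⁻²ȳ` by at most `δ₀/K` (CEHR (5.9): `z̃_σ ∈ K̃_E` on the event `Ã`;
here pathwise and unconditionally, the noise being small). [cite: CuneoEckmannHairerReyBellet2018, Lemma 5.10 and eq. (5.9)] -/
theorem pureQuartic_scalePath_bounds {K : ℝ} (hK : 1 ≤ K) (x : PhaseSpace N)
    (hx : (pureQuarticChain μ γ).hamiltonian N x ≤ 2 * K ^ 4)
    {η : ℝ → Fin N → ℝ} (hη : Continuous η) {Λ δ₀ : ℝ} (hδ₁ : δ₀ ≤ 1)
    (hM : ∀ s ∈ Icc 0 (Λ / K), ‖η s‖ ≤ δ₀ * K) (hAδ : pinnedChainScaleA γ N * δ₀ * Λ ≤ 1)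
    {σ : ℝ} (hσ : σ ∈ Icc 0 Λ) :
    (∀ i, |(scalePath K ((pureQuarticChain μ γ).chainFlow N x η) σ).2 i| ≤
        pinnedChainScaleC 0 μ 0 γ N + 3 / 2) ∧
    (∀ i : Fin N, ∀ h : i.val + 1 < N,
        |(scalePath K ((pureQuarticChain μ γ).chainFlow N x η) σ).1 ⟨i.val + 1, h⟩ -
          (scalePath K ((pureQuarticChain μ γ).chainFlow N x η) σ).1 i| ≤
        max 1 (4 * pinnedChainScaleC 0 μ 0 γ N)) ∧
    (∀ i, μ * (scalePath K ((pureQuarticChain μ γ).chainFlow N x η) σ).1 i ^ 2 ≤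
        μ + 4 * pinnedChainScaleC 0 μ 0 γ N) ∧
    (∀ i, |(scalePath K ((pureQuarticChain μ γ).chainFlow N x η) σ).2 i -
        (K ^ 2)⁻¹ * ((pureQuarticChain μ γ).chainFlow N x η (σ / K) -
          ((0 : Fin N → ℝ), η (σ / K))).2 i| ≤ δ₀ / K) := by
  set P := pureQuarticChain μ γ with hP
  set c₁ := pinnedChainScaleC 0 μ 0 γ N with hc₁
  set z := P.chainFlow N x η with hz
  set s := σ / K with hs
  have hK0 : 0 < K := by linarith
  have hΛ : 0 ≤ Λ := hσ.1.trans hσ.2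
  have hsI : s ∈ Icc 0 (Λ / K) := ⟨div_nonneg hσ.1 hK0.le, div_le_div_of_nonneg_right hσ.2 hK0.le⟩
  have hδ0 : 0 ≤ δ₀ := by
    have := (norm_nonneg _).trans (hM 0 ⟨le_rfl, div_nonneg hΛ hK0.le⟩)
    nlinarith
  have hAMT : pinnedChainScaleA γ N * (δ₀ * K) * (Λ / K) ≤ K := by
    have : pinnedChainScaleA γ N * (δ₀ * K) * (Λ / K) = pinnedChainScaleA γ N * δ₀ * Λ := by
      field_simp
    rw [this]
    exact hAδ.trans hK
  set y := z s - ((0 : Fin N → ℝ), η s) with hy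
  have hceil : P.hamiltonian N y ≤ c₁ * K ^ 4 :=
    pureQuarticChain_hamiltonian_chainFlow_le_ceiling hμ hγ N hK x hx hη hM hAMT s hsI
  have hc6 : 6 ≤ c₁ := six_le_pinnedChainScaleC le_rfl hμ.le le_rfl hγ N
  have hy1 : ∀ j, y.1 j = (z s).1 j := fun j => by simp [hy]
  have hy2 : ∀ j, (z s).2 j = y.2 j + η s j := fun j => by simp [hy]
  have hzs1 : ∀ j, (scalePath K z σ).1 j = K⁻¹ * (z s).1 j := fun j => rfl
  have hzs2 : ∀ j, (scalePath K z σ).2 j = (K ^ 2)⁻¹ * (z s).2 j := fun j => rfl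
  have hηi : ∀ j, |η s j| ≤ δ₀ * K := fun j =>
    (show |η s j| ≤ ‖η s‖ by rw [← Real.norm_eq_abs]; exact norm_le_pi_norm (η s) j).trans (hM s hsI)
  refine ⟨fun i => ?_, fun i h => ?_, fun i => ?_, fun i => ?_⟩
  · -- momenta
    rw [hzs2, hy2, abs_mul, abs_of_nonneg (by positivity)]
    have h1 := pureQuarticChain_abs_momentum_le_scale hμ.le γ N hK0 y i
    have h2 : P.hamiltonian N y / K ^ 2 ≤ c₁ * K ^ 4 / K ^ 2 := div_le_div_of_nonneg_right hceil (by positivity)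
    have h3 : c₁ * K ^ 4 / K ^ 2 = c₁ * K ^ 2 := by rw [div_eq_iff (by positivity)]; ring
    have h4 : |y.2 i + η s i| ≤ (c₁ + 1 / 2) * K ^ 2 + K ^ 2 := by
      calc |y.2 i + η s i| ≤ |y.2 i| + |η s i| := abs_add_le _ _
        _ ≤ (c₁ + 1 / 2) * K ^ 2 + K ^ 2 := by
            refine add_le_add (by linarith) ((hηi i).trans ?_)
            nlinarith
    calc (K ^ 2)⁻¹ * |y.2 i + η s i| ≤ (K ^ 2)⁻¹ * ((c₁ + 1 / 2) * K ^ 2 + K ^ 2) :=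
          mul_le_mul_of_nonneg_left h4 (by positivity)
      _ = c₁ + 3 / 2 := by field_simp; ring
  · -- bond stretches
    rw [hzs1, hzs1, ← mul_sub, ← hy1, ← hy1]
    refine abs_le_max_one_of_pow_four_le ?_
    have hb := pureQuarticChain_bond_le_hamiltonian hμ.le γ N y (i := i) (j := ⟨i.val + 1, h⟩) rfl
    have hb' : (y.1 ⟨i.val + 1, h⟩ - y.1 i) ^ 4 / 4 ≤ c₁ * K ^ 4 := hb.trans hceil
    rw [mul_pow, inv_pow, ← div_eq_inv_mul, div_le_iff₀ (by positivity)]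
    nlinarith [hb']
  · -- `μ q̃²`
    rw [hzs1, ← hy1]
    have hU := pureQuarticChain_U_le_hamiltonian hμ.le γ N y i
    have hl4 : μ * (K⁻¹ * y.1 i) ^ 4 ≤ 4 * c₁ := by
      rw [mul_pow, inv_pow]
      have : μ * y.1 i ^ 4 ≤ 4 * c₁ * K ^ 4 := by linarith
      calc μ * ((K ^ 4)⁻¹ * y.1 i ^ 4) = μ * y.1 i ^ 4 / K ^ 4 := by ring
        _ ≤ 4 * c₁ * K ^ 4 / K ^ 4 := div_le_div_of_nonneg_right this (by positivity)
        _ = 4 * c₁ := by field_simp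
    have hsq : (K⁻¹ * y.1 i) ^ 2 ≤ 1 + (K⁻¹ * y.1 i) ^ 4 := by nlinarith [sq_nonneg ((K⁻¹ * y.1 i) ^ 2 - 1)]
    nlinarith [mul_le_mul_of_nonneg_left hsq hμ.le]
  · -- rescaled momentum vs rescaled smooth momentum
    rw [hzs2, hy2]
    have : (K ^ 2)⁻¹ * (y.2 i + η s i) - (K ^ 2)⁻¹ * y.2 i = (K ^ 2)⁻¹ * η s i := by ring
    rw [this, abs_mul, abs_of_nonneg (by positivity)]
    calc (K ^ 2)⁻¹ * |η s i| ≤ (K ^ 2)⁻¹ * (δ₀ * K) := mul_le_mul_of_nonneg_left (hηi i) (by positivity)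
      _ = δ₀ / K := by field_simp

end DrivenPath
/-! ### The dissipation bound in the interaction regime (CEHR Prop. 5.3, case `H_i ≥ H/2`) -/

section Main

variable {μ γ : ℝ}

set_option maxHeartbeats 1600000 in
/-- **High-energy dissipation over the short window, interaction regime** (CEHR Prop. 5.3 with
§5.1, pathwise): fix `Λ > 0` and a noise size `δ₀ ∈ (0, 1]` with `Aδ₀Λ ≤ 1`. There are `K₀ ≥ 1`
and `ε > 0` such that for every scale `K ≥ K₀`, every initial condition with `H(x) ≤ 2K⁴` whose
rescaled point has limit energy `Ĥ(rescale K x) ≥ 1/2` (the interaction-dominated regime; for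
`μ > 0` automatic at high energy, `pureQuartic_limitChain_hamiltonian_ge_half`), and every continuous noise path with `‖η‖ ≤ δ₀K` on the
window `[0, Λ/K]`, the dissipation of the smooth part satisfies
`γ ∫₀^{Λ/K} ∑_i w_i ȳ_i(s)² ds ≥ ε K³`. Proof: rescale (`scalePath_eq`); the rescaled path solves the
limit equation up to the forcing `G` with `‖G - x̃‖ ≤ (δ₀ + ΛC)/K` and stays in the region
`S(Cp, Cd, Cq)` (`pureQuartic_scalePath_bounds`); the reference limit solution from the
rescaled point stays there too and dissipates at least `ε₁` (`exists_le_limitDissipation`,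
Prop. 5.14); Grönwall (`IsIntegralSolutionOn.norm_sub_le_mul_exp`, Lemma 5.8/5.17) makes the two
`O(1/K)`-close, so the rescaled path dissipates at least `ε₁/4` for `K` large, i.e. `εK³` in the
original variables. [cite: CuneoEckmannHairerReyBellet2018, Prop 5.3, Lemma 5.17 and eq. (5.9)] -/
theorem pureQuarticChain_dissipation_ge_interaction (hμ : 0 < μ) (hγ : 0 < γ) (hN : 0 < N) {Λ δ₀ : ℝ} (hΛ : 0 < Λ) (hδ₀ : 0 < δ₀) (hδ₁ : δ₀ ≤ 1)
    (hAδ : pinnedChainScaleA γ N * δ₀ * Λ ≤ 1) :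
    ∃ K₀ ε : ℝ, 1 ≤ K₀ ∧ 0 < ε ∧ ∀ K : ℝ, K₀ ≤ K → ∀ x : PhaseSpace N,
      (pureQuarticChain μ γ).hamiltonian N x ≤ 2 * K ^ 4 →
      1 / 2 ≤ (limitChain μ 1).hamiltonian N (rescale K x) →
      ∀ η : ℝ → Fin N → ℝ, Continuous η → (∀ s ∈ Icc 0 (Λ / K), ‖η s‖ ≤ δ₀ * K) →
        ε * K ^ 3 ≤ γ * ∫ s in (0 : ℝ)..Λ / K, ∑ i, bathWeight N i *
          ((pureQuarticChain μ γ).chainFlow N x η s - ((0 : Fin N → ℝ), η s)).2 i ^ 2 := by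
  -- the constants
  set c₁ := pinnedChainScaleC 0 μ 0 γ N with hc₁
  have hc6 : 6 ≤ c₁ := six_le_pinnedChainScaleC le_rfl hμ.le le_rfl hγ.le N
  set Cp : ℝ := c₁ + 3 / 2 with hCp
  set Cd : ℝ := max 1 (4 * c₁) with hCd
  set Cq : ℝ := μ + 4 * c₁ with hCq
  have hCp0 : 0 ≤ Cp := by positivity
  have hCd1 : 1 ≤ Cd := le_max_left _ _
  have hCd0 : 0 ≤ Cd := zero_le_one.trans hCd1
  have hCq0 : 0 ≤ Cq := by positivity
  set L : ℝ := 1 + 3 * Cq + 12 * 1 * Cd ^ 2 with hL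
  have hL0 : 0 ≤ L := by positivity
  set ρ : ℝ := N * Cd + max 1 (8 / μ) with hρ
  have hρ0 : 0 ≤ ρ := by positivity
  set R : ℝ := Real.sqrt (N * ((ρ + (2 + 1 / 2) * Λ) ^ 2 + (2 + 1 / 2) ^ 2)) + 1 with hRdef
  have hR : 0 < R := by positivity
  have hRad : N * ((ρ + (2 + 1 / 2) * Λ) ^ 2 + (2 + 1 / 2) ^ 2) ≤ R ^ 2 := by
    have h0 : 0 ≤ (N : ℝ) * ((ρ + (2 + 1 / 2) * Λ) ^ 2 + (2 + 1 / 2) ^ 2) := by positivity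
    have h1 := Real.sq_sqrt h0
    nlinarith [Real.sqrt_nonneg ((N : ℝ) * ((ρ + (2 + 1 / 2) * Λ) ^ 2 + (2 + 1 / 2) ^ 2))]
  obtain ⟨ε₁, hε₁, hF⟩ := exists_le_limitDissipation (lam := μ) (β := 1) N hR hμ.le one_pos hN hΛ
    (h₀ := 2) (h₁ := 1 / 2) (ρ := ρ) (by norm_num) hRad
  set Cpert : ℝ := 2 * γ * Cp with hCpert
  have hCpert0 : 0 ≤ Cpert := by positivity
  set D₀ : ℝ := (δ₀ + Λ * Cpert) * Real.exp (L * Λ) + δ₀ with hD₀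
  have hD₀0 : 0 ≤ D₀ := by positivity
  set K₀ : ℝ := max 1 (8 * Λ * D₀ ^ 2 / ε₁ + 1) with hK₀
  refine ⟨K₀, γ * ε₁ / 4, le_max_left _ _, by positivity, ?_⟩
  intro K hK x hx hhalf η hη hM
  have hK1 : 1 ≤ K := (le_max_left _ _).trans hK
  have hK0 : 0 < K := by linarith
  have hKD : 8 * Λ * D₀ ^ 2 / ε₁ ≤ K := by
    have := (le_max_right _ _).trans hK
    linarith
  set P := pureQuarticChain μ γ with hP
  set z := P.chainFlow N x η with hz
  set xs := rescale K x with hxs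
  set zs := scalePath K z with hzs
  set Yhat := (limitChain μ 1).drift N with hYhat
  -- (a) the integral equation on the window and its rescaling
  have hzIE : ∀ s ∈ Icc 0 (Λ / K), z s = x + ((0 : Fin N → ℝ), η s) +
      ∫ r in (0 : ℝ)..s, P.drift N (z r) :=
    pureQuarticChain_isIntegralSolutionOn_chainFlow hμ hγ.le N x hη (Λ / K)
  have hzc : Continuous z := pureQuarticChain_continuous_chainFlow hμ hγ.le N x hη
  have hzsc : Continuous zs := continuous_scalePath K hzc
  have hzsIE : ∀ σ ∈ Icc 0 Λ, zs σ = xs + ((0 : Fin N → ℝ), fun i => (K ^ 2)⁻¹ * η (σ / K) i) +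
      ∫ r in (0 : ℝ)..σ, pureQuarticScaledDrift μ γ N K (zs r) := fun σ hσ =>
    pureQuartic_scalePath_eq hK0 hzc hzIE hσ
  -- (b) bounds along the rescaled path, membership in the region, the perturbation
  have hbd := fun σ (hσ : σ ∈ Icc 0 Λ) =>
    pureQuartic_scalePath_bounds hμ hγ.le N hK1 x hx hη hδ₁ hM hAδ hσ
  have hmem : ∀ σ ∈ Icc 0 Λ, zs σ ∈ scaleRegion μ N Cp Cd Cq := fun σ hσ =>
    ⟨(hbd σ hσ).1, (hbd σ hσ).2.1, (hbd σ hσ).2.2.1⟩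
  have hpert : ∀ σ ∈ Icc 0 Λ, ‖pureQuarticScaledDrift μ γ N K (zs σ) - Yhat (zs σ)‖ ≤ Cpert / K :=
    fun σ hσ => norm_pureQuarticScaledDrift_sub_drift_le hγ.le hK0 hCp0 (hbd σ hσ).1
  -- (c) the rescaled path solves the limit equation with the forcing `G`
  have hYs : Continuous fun r => pureQuarticScaledDrift μ γ N K (zs r) :=
    (continuous_pureQuarticScaledDrift μ γ N K).comp hzsc
  have hYh : Continuous fun r => Yhat (zs r) := (limitChain_contDiff_drift μ 1 N (n := 0)).continuous.comp hzsc
  set G : ℝ → PhaseSpace N := fun σ => xs + ((0 : Fin N → ℝ), fun i => (K ^ 2)⁻¹ * η (σ / K) i) +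
    ∫ r in (0 : ℝ)..σ, (pureQuarticScaledDrift μ γ N K (zs r) - Yhat (zs r)) with hG
  have hGIE : IsIntegralSolutionOn Yhat G zs Λ := by
    intro σ hσ
    rw [hG]
    simp only
    rw [intervalIntegral.integral_sub (hYs.intervalIntegrable _ _) (hYh.intervalIntegrable _ _), hzsIE σ hσ]
    abel
  have hGδ : ∀ σ ∈ Icc 0 Λ, ‖G σ - xs‖ ≤ (δ₀ + Λ * Cpert) / K := by
    intro σ hσ
    have e : G σ - xs = ((0 : Fin N → ℝ), fun i => (K ^ 2)⁻¹ * η (σ / K) i) +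
        ∫ r in (0 : ℝ)..σ, (pureQuarticScaledDrift μ γ N K (zs r) - Yhat (zs r)) := by
      rw [hG]; simp only; abel
    rw [e]
    have h1 : ‖(((0 : Fin N → ℝ), fun i => (K ^ 2)⁻¹ * η (σ / K) i) : PhaseSpace N)‖ ≤ δ₀ / K := by
      rw [Prod.norm_def, norm_zero, max_le_iff]
      refine ⟨by positivity, (pi_norm_le_iff_of_nonneg (by positivity)).2 fun i => ?_⟩
      have := (hbd σ hσ).2.2.2 i
      have hcomp : (scalePath K ((pureQuarticChain μ γ).chainFlow N x η) σ).2 i -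
          (K ^ 2)⁻¹ * ((pureQuarticChain μ γ).chainFlow N x η (σ / K) - ((0 : Fin N → ℝ), η (σ / K))).2 i =
          (K ^ 2)⁻¹ * η (σ / K) i := by
        simp only [scalePath, rescale_snd, Prod.snd_sub, Pi.sub_apply]
        ring
      rw [hcomp] at this
      rwa [Real.norm_eq_abs]
    have h2 : ‖∫ r in (0 : ℝ)..σ, (pureQuarticScaledDrift μ γ N K (zs r) - Yhat (zs r))‖ ≤ Cpert / K * |σ - 0| :=
      intervalIntegral.norm_integral_le_of_norm_le_const fun r hr => by
        rw [uIoc_of_le hσ.1] at hr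
        exact hpert r ⟨hr.1.le, hr.2.trans hσ.2⟩
    rw [sub_zero, abs_of_nonneg hσ.1] at h2
    calc ‖(((0 : Fin N → ℝ), fun i => (K ^ 2)⁻¹ * η (σ / K) i) : PhaseSpace N) +
          ∫ r in (0 : ℝ)..σ, (pureQuarticScaledDrift μ γ N K (zs r) - Yhat (zs r))‖
        ≤ δ₀ / K + Cpert / K * σ := (norm_add_le _ _).trans (add_le_add h1 h2)
      _ ≤ δ₀ / K + Cpert / K * Λ := by gcongr; exact hσ.2
      _ = (δ₀ + Λ * Cpert) / K := by ring
  -- (d) the reference solution of the limit system (no translation is needed: `μ > 0`)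
  set c : ℝ := 0 with hcdef
  have hc : μ * c = 0 := by rw [hcdef, mul_zero]
  set xh : PhaseSpace N := xs + shiftVec N (-c) with hxh
  have hxh_xs : xh + shiftVec N c = xs := by
    rw [hxh]; ext i <;> simp [shiftVec]
  have hHxs : (limitChain μ 1).hamiltonian N xs ≤ 2 := by
    have h2 := pureQuarticChain_hamiltonian_eq_scaled μ γ hK0.ne' N x
    have hK4 : 0 < K ^ 4 := by positivity
    refine le_of_mul_le_mul_left ?_ hK4
    rw [← h2]
    linarith
  have hnc : μ * -c = 0 := by rw [mul_neg, hc, neg_zero]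
  have hHxh : (limitChain μ 1).hamiltonian N xh = (limitChain μ 1).hamiltonian N xs := by
    rw [hxh, limitChain_hamiltonian_shift hnc]
  have hxh2 : (limitChain μ 1).hamiltonian N xh ≤ 2 := hHxh ▸ hHxs
  have hxh1 : 1 / 2 ≤ (limitChain μ 1).hamiltonian N xh := hHxh ▸ hhalf
  -- position bound of the gauge-fixed point
  have h0mem : (0 : ℝ) ∈ Icc 0 Λ := ⟨le_rfl, hΛ.le⟩
  have hzs0 : ∀ j, (zs 0).1 j = xs.1 j := fun j => by
    simp only [hzs, scalePath, zero_div, hxs, rescale_fst, hz]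
    rw [pureQuarticChain_chainFlow_of_nonpos μ γ N x hη le_rfl]
    simp
  have hxsd : ∀ i : Fin N, ∀ h : i.val + 1 < N, |xs.1 ⟨i.val + 1, h⟩ - xs.1 i| ≤ Cd := by
    intro i h
    have := (hbd 0 h0mem).2.1 i h
    rw [← hzs0, ← hzs0]
    exact this
  have hxhρ : ∀ i, |xh.1 i| ≤ ρ := by
    intro i
    rw [hxh, shiftVec_fst, hcdef, neg_zero, add_zero]
    have hU := limitChain_U_le_hamiltonian hμ.le zero_le_one N xs i
    have h4 : xs.1 i ^ 4 ≤ 8 / μ := by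
      rw [le_div_iff₀ hμ]; nlinarith
    calc |xs.1 i| ≤ max 1 (8 / μ) := abs_le_max_one_of_pow_four_le h4
      _ ≤ ρ := by rw [hρ]; linarith [mul_nonneg (Nat.cast_nonneg N) hCd0]
  set zh : ℝ → PhaseSpace N := fun σ => limitChainFlow μ 1 N hR xh σ + shiftVec N c with hzh
  have hzhc : Continuous zh := (continuous_limitChainFlow_right μ 1 N hR xh).add continuous_const
  have hzhIE : IsIntegralSolutionOn Yhat (fun _ => xs) zh Λ := by
    intro σ hσ
    have h1 := limitChainFlow_eq_add_integral N hR hμ.le zero_le_one (h₀ := 2) (ρ := ρ) (Λ := Λ) hRad hxh2 hxhρ hσ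
    have h2 : ∀ r, Yhat (zh r) = Yhat (limitChainFlow μ 1 N hR xh r) := fun r => by
      rw [hzh]; exact limitChain_drift_shift hc _
    simp_rw [h2]
    rw [hzh]
    simp only
    rw [h1, add_assoc, add_comm (∫ r in (0:ℝ)..σ, Yhat (limitChainFlow μ 1 N hR xh r)) (shiftVec N c),
      ← add_assoc, hxh_xs]
  have hzhmem : ∀ σ ∈ Icc 0 Λ, zh σ ∈ scaleRegion μ N Cp Cd Cq := by
    intro σ _
    have hb := limitChainFlow_shift_bounds hμ.le one_pos N hR hxh2 hc σ
    refine ⟨fun i => (hb.1 i).trans (by rw [hCp]; linarith), fun i h => (hb.2.1 i h).trans ?_,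
      fun i => (hb.2.2 i).trans (by rw [hCq]; linarith)⟩
    rw [hCd]
    refine max_le_max le_rfl ?_
    rw [div_one]; linarith
  -- (e) Grönwall
  have hLip := lipschitzOnWith_limitChain_drift (N := N) hμ.le zero_le_one (Cp := Cp) (Cd := Cd) hCq0
  have hclose : ∀ σ ∈ Icc 0 Λ, ‖zs σ - zh σ‖ ≤ (δ₀ + Λ * Cpert) / K * Real.exp (L * Λ) := by
    intro σ hσ
    have h := IsIntegralSolutionOn.norm_sub_le_mul_exp hLip hGIE hzhIE hzsc hzhc hmem hzhmem
      (δ := (δ₀ + Λ * Cpert) / K) (fun t ht => by simpa using hGδ t ht) σ hσ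
    refine h.trans (mul_le_mul_of_nonneg_left ?_ (by positivity))
    rw [Real.coe_toNNReal _ hL0]
    exact Real.exp_le_exp.2 (mul_le_mul_of_nonneg_left hσ.2 hL0)
  -- (f) dissipation of the reference
  have hFxh : ε₁ ≤ limitDissipation μ 1 N hR Λ xh := hF xh hxh1 hxh2 hxhρ
  -- (g) transfer to the rescaled smooth momenta `K⁻² ȳ(σ/K)`
  set ys : ℝ → Fin N → ℝ := fun σ i =>
    (K ^ 2)⁻¹ * (z (σ / K) - ((0 : Fin N → ℝ), η (σ / K))).2 i with hys
  have hΔ : ∀ σ ∈ Icc 0 Λ, ∀ i, |ys σ i - (limitChainFlow μ 1 N hR xh σ).2 i| ≤ D₀ / K := by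
    intro σ hσ i
    have h1 : |(zs σ).2 i - ys σ i| ≤ δ₀ / K := (hbd σ hσ).2.2.2 i
    have h2 : |(zs σ).2 i - (zh σ).2 i| ≤ (δ₀ + Λ * Cpert) / K * Real.exp (L * Λ) := by
      have := hclose σ hσ
      calc |(zs σ).2 i - (zh σ).2 i| = |(zs σ - zh σ).2 i| := by simp
        _ ≤ ‖zs σ - zh σ‖ := by
            rw [← Real.norm_eq_abs]; exact (norm_le_pi_norm (zs σ - zh σ).2 i).trans (norm_snd_le _)
        _ ≤ _ := this
    have h3 : (zh σ).2 i = (limitChainFlow μ 1 N hR xh σ).2 i := by rw [hzh]; exact shiftVec_snd c _ i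
    rw [← h3]
    calc |ys σ i - (zh σ).2 i| = |((zs σ).2 i - (zh σ).2 i) - ((zs σ).2 i - ys σ i)| := by ring_nf
      _ ≤ |(zs σ).2 i - (zh σ).2 i| + |(zs σ).2 i - ys σ i| := abs_sub _ _
      _ ≤ (δ₀ + Λ * Cpert) / K * Real.exp (L * Λ) + δ₀ / K := add_le_add h2 h1
      _ = D₀ / K := by rw [hD₀]; ring
  have hw0 : ∀ i, 0 ≤ bathWeight N i := fun i => by unfold bathWeight; split_ifs <;> norm_num
  have hpt : ∀ σ ∈ Icc 0 Λ, (1 / 2) * (∑ i, bathWeight N i * (limitChainFlow μ 1 N hR xh σ).2 i ^ 2) -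
      2 * (D₀ / K) ^ 2 ≤ ∑ i, bathWeight N i * ys σ i ^ 2 := by
    intro σ hσ
    have h1 : ∀ i, bathWeight N i * ((limitChainFlow μ 1 N hR xh σ).2 i ^ 2 / 2 - (D₀ / K) ^ 2) ≤
        bathWeight N i * ys σ i ^ 2 := by
      intro i
      refine mul_le_mul_of_nonneg_left ?_ (hw0 i)
      have h := half_sq_sub_sq_le (ys σ i) ((limitChainFlow μ 1 N hR xh σ).2 i)
      have hd : (ys σ i - (limitChainFlow μ 1 N hR xh σ).2 i) ^ 2 ≤ (D₀ / K) ^ 2 := by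
        rw [← sq_abs]; exact pow_le_pow_left₀ (abs_nonneg _) (hΔ σ hσ i) 2
      linarith
    have h2 := Finset.sum_le_sum fun i (_ : i ∈ Finset.univ) => h1 i
    have h3 : ∑ i, bathWeight N i * ((limitChainFlow μ 1 N hR xh σ).2 i ^ 2 / 2 - (D₀ / K) ^ 2) =
        (1 / 2) * (∑ i, bathWeight N i * (limitChainFlow μ 1 N hR xh σ).2 i ^ 2) -
          (∑ i, bathWeight N i) * (D₀ / K) ^ 2 := by
      rw [Finset.mul_sum, Finset.sum_mul, ← Finset.sum_sub_distrib]
      exact Finset.sum_congr rfl fun i _ => by ring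
    rw [h3, sum_bathWeight hN] at h2
    exact h2
  -- integrate over `[0, Λ]`
  have hysc : Continuous fun σ => ∑ i, bathWeight N i * ys σ i ^ 2 := by
    have hc1 : Continuous fun σ => z (σ / K) - ((0 : Fin N → ℝ), η (σ / K)) :=
      (hzc.comp (continuous_id.div_const K)).sub
        (continuous_const.prodMk (hη.comp (continuous_id.div_const K)))
    refine continuous_finsetSum _ fun i _ => continuous_const.mul ?_
    exact (continuous_const.mul ((continuous_apply i).comp (continuous_snd.comp hc1))).pow 2
  have hlimc : Continuous fun σ => ∑ i, bathWeight N i * (limitChainFlow μ 1 N hR xh σ).2 i ^ 2 :=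
    (continuous_limitDissipation_integrand μ 1 N hR).comp (Continuous.prodMk_right xh)
  have hint : ε₁ / 4 ≤ ∫ σ in (0 : ℝ)..Λ, ∑ i, bathWeight N i * ys σ i ^ 2 := by
    have h1 : ∫ σ in (0 : ℝ)..Λ, ((1 / 2) * (∑ i, bathWeight N i * (limitChainFlow μ 1 N hR xh σ).2 i ^ 2) -
        2 * (D₀ / K) ^ 2) ≤ ∫ σ in (0 : ℝ)..Λ, ∑ i, bathWeight N i * ys σ i ^ 2 :=
      intervalIntegral.integral_mono_on hΛ.le
        (((hlimc.const_mul _).sub continuous_const).intervalIntegrable _ _)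
        (hysc.intervalIntegrable _ _) fun σ hσ => hpt σ hσ
    rw [intervalIntegral.integral_sub ((hlimc.const_mul _).intervalIntegrable _ _)
      (continuous_const.intervalIntegrable _ _), intervalIntegral.integral_const_mul,
      intervalIntegral.integral_const, sub_zero, smul_eq_mul] at h1
    unfold limitDissipation at hFxh
    -- `2 Λ (D₀/K)² ≤ ε₁/4` from `K ≥ 8ΛD₀²/ε₁` and `K ≥ 1`
    have h3 : Λ * (2 * (D₀ / K) ^ 2) ≤ ε₁ / 4 := by
      have hK2 : K ≤ K ^ 2 := by nlinarith only [hK1]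
      have h4 : 8 * Λ * D₀ ^ 2 ≤ ε₁ * K := by
        have := mul_le_mul_of_nonneg_left hKD hε₁.le
        rwa [mul_div_cancel₀ _ hε₁.ne'] at this
      have h6 : ε₁ * K ≤ ε₁ * K ^ 2 := mul_le_mul_of_nonneg_left hK2 hε₁.le
      rw [div_pow]
      have h5 : Λ * (2 * (D₀ ^ 2 / K ^ 2)) = 2 * Λ * D₀ ^ 2 / K ^ 2 := by ring
      rw [h5, div_le_iff₀ (by positivity)]
      linarith only [h4, h6]
    linarith only [h1, h3, hFxh]
  -- (h) back to the original time: `∫₀^{Λ/K} ∑ w ȳ² = K³ ∫₀^Λ ∑ w (K⁻²ȳ(σ/K))²`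
  have hunscale : ∫ s in (0 : ℝ)..Λ / K, ∑ i, bathWeight N i *
      (z s - ((0 : Fin N → ℝ), η s)).2 i ^ 2 = K ^ 3 * ∫ σ in (0 : ℝ)..Λ, ∑ i, bathWeight N i * ys σ i ^ 2 := by
    have h1 : ∀ σ, ∑ i, bathWeight N i * ys σ i ^ 2 =
        (K ^ 4)⁻¹ * ∑ i, bathWeight N i * (z (σ / K) - ((0 : Fin N → ℝ), η (σ / K))).2 i ^ 2 := by
      intro σ
      rw [Finset.mul_sum]
      refine Finset.sum_congr rfl fun i _ => ?_
      simp only [hys]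
      have : (K ^ 4)⁻¹ = (K ^ 2)⁻¹ * (K ^ 2)⁻¹ := by rw [← mul_inv, ← pow_add]
      rw [this]; ring
    simp_rw [h1]
    rw [intervalIntegral.integral_const_mul,
      intervalIntegral.integral_comp_div (fun s => ∑ i, bathWeight N i *
        (z s - ((0 : Fin N → ℝ), η s)).2 i ^ 2) hK0.ne', zero_div, smul_eq_mul]
    field_simp
  rw [hunscale]
  have hγK : 0 ≤ γ * K ^ 3 := by positivity
  calc γ * ε₁ / 4 * K ^ 3 = γ * K ^ 3 * (ε₁ / 4) := by ring
    _ ≤ γ * K ^ 3 * ∫ σ in (0 : ℝ)..Λ, ∑ i, bathWeight N i * ys σ i ^ 2 :=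
        mul_le_mul_of_nonneg_left hint hγK
    _ = γ * (K ^ 3 * ∫ σ in (0 : ℝ)..Λ, ∑ i, bathWeight N i * ys σ i ^ 2) := by ring

end Main

end PartScaleCloseness

end Literature.MathematicalPhysics.KineticTheory.HeatConduction
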